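import Mathlib.MeasureTheory.Integral.MeanInequalities
import Mathlib.MeasureTheory.Measure.Prod
import HarnessLib

/-!
# Schur's test for positive kernels on `L^p` (weighted form)

Analysis/SingularIntegrals support file (everything proved) on the discharge path of the named
fact `Literature.Analysis.FluidPDE.grafakos2014_normalisedPressure_powerWeight_bound`
(`FluidPDE/NormalisedPressurePowerWeightBound`; the power-weighted `L^p` bound for the
Riesz-type operator of the normalised pressure), which is obtained from the tree's (proved)
unweighted Calderón–Zygmund theory by E. M. Stein's 1957 device (*Note on singular integrals*,
Proc. Amer. Math. Soc. 8 (1957) 250–254): the commutator of a singular integral with the power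
`|x|^α` is dominated by a *positive* operator with a kernel homogeneous of degree `-n`, and such
operators are bounded on `L^p` (Stein's Lemma, *loc. cit.* p. 251). We prove Stein's Lemma (next
file, `SingularIntegrals/SteinPowerWeights`) by **Schur's test** with power test functions, and
this file supplies Schur's test in the generality of two `σ`-finite measure spaces and
`ℝ≥0∞`-valued kernels, in the form of L. Grafakos, *Modern Fourier Analysis*, 2nd ed. (2009),
**Appendix A.2** ("Schur's Lemma for Positive Operators"), implication (iii) ⇒ (i): *if
`K ≥ 0` is measurable on `X × Y`, `T(f)(x) = ∫_Y K(x,y) f(y) dν`, `Tᵗ(g)(y) = ∫_X K(x,y) g(x) dμ`,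
and there are measurable `u, v`, `0 < u, v < ∞` a.e., with `T(u^{p'}) ≤ B v^{p'}` and
`Tᵗ(v^p) ≤ B u^p`, then `‖T(f)‖_{L^p(X)} ≤ B ‖f‖_{L^p(Y)}`* (`1 < p < ∞`). We keep two constants
(`C₁` for the row bound, `C₂` for the column bound, giving the norm `C₁^{1/p'} C₂^{1/p}`), name
the test functions the other way round (`v` on `Y` in the row bound, `u` on `X` in the column
bound), need `0 < v < ∞` a.e. only, and prove the `lintegral` inequality
`∫_X (∫_Y K f dν)^p dμ ≤ C₁^{p/p'} C₂ ∫_Y f^p dν` for measurable `f ≥ 0` directly by Hölder in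
the inner integral (Grafakos applies Hölder on `X × Y` against `K dν dμ` after pairing with
`g ∈ L^{p'}`; the pointwise form avoids duality):
`∫ K f = ∫ (K^{1/p'} v)(K^{1/p} f v⁻¹) ≤ (∫ K v^{p'})^{1/p'} (∫ K f^p v^{-p})^{1/p}`, raise to the
`p`-th power, integrate in `x`, Tonelli, and the column hypothesis.

## Main statements

* `lintegral_kernel_mul_le`: the Hölder step.
* `lintegral_rpow_lintegral_le_of_schur`: Schur's test (`ℝ≥0∞`-valued, `lintegral` form).

## Mathlib / tree search

Mathlib: `ENNReal.lintegral_mul_le_Lp_mul_Lq` (Hölder for `lintegral`), `lintegral_lintegral_swap`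
(Tonelli) — used; no Schur test (`lean search -i schur`: Schur's lemma, Schur complement, Issai
Schur only). Tree: an `L²` Schur test for one specific kernel,
`Literature.Analysis.FluidPDE.lintegral_lintegral_schurKernel_mul_mul_le` (`FluidPDE/TaoFourierSchur`),
not reusable for `p ≠ 2`.

## References

* L. Grafakos, *Modern Fourier Analysis*, 2nd ed., GTM 250, Springer (2009), Appendix A.2
  (Schur's lemma for positive operators) [Grafakos2009].
* E. M. Stein, *Note on singular integrals*, Proc. Amer. Math. Soc. 8 (1957) 250–254 (the
  application, next file) [Stein1957].
-/

noncomputable section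

open MeasureTheory Function
open scoped ENNReal NNReal

namespace Literature.Analysis.SingularIntegrals

variable {X Y : Type*} [MeasurableSpace X] [MeasurableSpace Y] {μ : Measure X} {ν : Measure Y}

/-- **The Hölder step of Schur's test**: for `1/p + 1/q = 1`, a measurable kernel slice
`k ≥ 0`, a measurable `v` with `0 < v < ∞` a.e. and measurable `f ≥ 0`,
`∫ k f ≤ (∫ k v^q)^{1/q} (∫ k (f/v)^p)^{1/p}` (write `k f = (k^{1/q} v) · (k^{1/p} f v⁻¹)`).
[cite: Grafakos2009, Appendix A.2] -/
theorem lintegral_kernel_mul_le {p q : ℝ} (hpq : p.HolderConjugate q) {k : Y → ℝ≥0∞}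
    (hk : Measurable k) {v : Y → ℝ≥0∞} (hv : Measurable v) (hv0 : ∀ᵐ y ∂ν, v y ≠ 0)
    (hvtop : ∀ᵐ y ∂ν, v y ≠ ⊤) {f : Y → ℝ≥0∞} (hf : Measurable f) :
    ∫⁻ y, k y * f y ∂ν ≤
      (∫⁻ y, k y * v y ^ q ∂ν) ^ (1 / q) * (∫⁻ y, k y * (f y * (v y)⁻¹) ^ p ∂ν) ^ (1 / p) := by
  have hp : 0 < p := hpq.pos
  have hq : 0 < q := hpq.symm.pos
  have hsum : 1 / q + 1 / p = 1 := by
    rw [one_div, one_div, add_comm]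
    exact hpq.inv_add_inv_eq_one
  calc ∫⁻ y, k y * f y ∂ν
      = ∫⁻ y, (k y ^ (1 / q) * v y) * (k y ^ (1 / p) * (f y * (v y)⁻¹)) ∂ν := by
        refine lintegral_congr_ae ?_
        filter_upwards [hv0, hvtop] with y h0 htop
        calc k y * f y = (k y ^ (1 / q) * k y ^ (1 / p)) * ((v y * (v y)⁻¹) * f y) := by
              rw [← ENNReal.rpow_add_of_nonneg _ _ (by positivity) (by positivity), hsum,
                ENNReal.rpow_one, ENNReal.mul_inv_cancel h0 htop, one_mul]
          _ = (k y ^ (1 / q) * v y) * (k y ^ (1 / p) * (f y * (v y)⁻¹)) := by ring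
    _ ≤ (∫⁻ y, (k y ^ (1 / q) * v y) ^ q ∂ν) ^ (1 / q) *
          (∫⁻ y, (k y ^ (1 / p) * (f y * (v y)⁻¹)) ^ p ∂ν) ^ (1 / p) :=
        ENNReal.lintegral_mul_le_Lp_mul_Lq ν hpq.symm
          ((hk.pow_const _).mul hv).aemeasurable
          ((hk.pow_const _).mul (hf.mul hv.inv)).aemeasurable
    _ = (∫⁻ y, k y * v y ^ q ∂ν) ^ (1 / q) * (∫⁻ y, k y * (f y * (v y)⁻¹) ^ p ∂ν) ^ (1 / p) := by
        congr 1
        · congr 1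
          refine lintegral_congr fun y => ?_
          rw [ENNReal.mul_rpow_of_nonneg _ _ hq.le, ← ENNReal.rpow_mul, one_div_mul_cancel hq.ne',
            ENNReal.rpow_one]
        · congr 1
          refine lintegral_congr fun y => ?_
          rw [ENNReal.mul_rpow_of_nonneg _ _ hp.le, ← ENNReal.rpow_mul, one_div_mul_cancel hp.ne',
            ENNReal.rpow_one]

/-- **Schur's test** (weighted form, `1 < p < ∞`, `1/p + 1/q = 1`): if `K ≥ 0` is measurable on
`X × Y`, `u`, `v` are measurable with `0 < v < ∞` a.e., `∫_Y K(x,y) v(y)^q dν ≤ C₁ u(x)^q` for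
a.e. `x` and `∫_X K(x,y) u(x)^p dμ ≤ C₂ v(y)^p` for a.e. `y`, then for every measurable `f ≥ 0`,
`∫_X (∫_Y K(x,y) f(y) dν)^p dμ ≤ C₁^{p/q} C₂ ∫_Y f^p dν`; that is, the positive operator
`f ↦ ∫ K(·,y) f(y) dν(y)` maps `L^p(ν) → L^p(μ)` with norm at most `C₁^{1/q} C₂^{1/p}`
(Grafakos 2009, Appendix A.2, (iii) ⇒ (i), with separate row/column constants; Hölder as in
`lintegral_kernel_mul_le`, then Tonelli and the column bound). [cite: Grafakos2009, Appendix A.2] -/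
theorem lintegral_rpow_lintegral_le_of_schur [SFinite μ] [SFinite ν] {p q : ℝ}
    (hpq : p.HolderConjugate q) {K : X → Y → ℝ≥0∞} (hK : Measurable (uncurry K))
    {u : X → ℝ≥0∞} (hu : Measurable u) {v : Y → ℝ≥0∞} (hv : Measurable v)
    (hv0 : ∀ᵐ y ∂ν, v y ≠ 0) (hvtop : ∀ᵐ y ∂ν, v y ≠ ⊤) {C₁ C₂ : ℝ≥0∞}
    (hrow : ∀ᵐ x ∂μ, ∫⁻ y, K x y * v y ^ q ∂ν ≤ C₁ * u x ^ q)
    (hcol : ∀ᵐ y ∂ν, ∫⁻ x, K x y * u x ^ p ∂μ ≤ C₂ * v y ^ p)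
    {f : Y → ℝ≥0∞} (hf : Measurable f) :
    ∫⁻ x, (∫⁻ y, K x y * f y ∂ν) ^ p ∂μ ≤ C₁ ^ (p / q) * C₂ * ∫⁻ y, f y ^ p ∂ν := by
  have hp : 0 < p := hpq.pos
  have hq : 0 < q := hpq.symm.pos
  have hKx : ∀ x, Measurable (K x) := fun x => hK.comp measurable_prodMk_left
  have hKy : ∀ y, Measurable fun x => K x y := fun y => hK.comp measurable_prodMk_right
  set g : Y → ℝ≥0∞ := fun y => (f y * (v y)⁻¹) ^ p with hg
  have hgm : Measurable g := (hf.mul hv.inv).pow_const _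
  -- Step 1: the pointwise bound (Hölder and the row hypothesis)
  have h1 : ∀ᵐ x ∂μ, (∫⁻ y, K x y * f y ∂ν) ^ p ≤
      C₁ ^ (p / q) * u x ^ p * ∫⁻ y, K x y * g y ∂ν := by
    filter_upwards [hrow] with x hx
    calc (∫⁻ y, K x y * f y ∂ν) ^ p
        ≤ ((∫⁻ y, K x y * v y ^ q ∂ν) ^ (1 / q) *
            (∫⁻ y, K x y * (f y * (v y)⁻¹) ^ p ∂ν) ^ (1 / p)) ^ p := by
          gcongr
          exact lintegral_kernel_mul_le hpq (hKx x) hv hv0 hvtop hf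
      _ ≤ ((C₁ * u x ^ q) ^ (1 / q) * (∫⁻ y, K x y * (f y * (v y)⁻¹) ^ p ∂ν) ^ (1 / p)) ^ p := by
          gcongr
      _ = C₁ ^ (p / q) * u x ^ p * ∫⁻ y, K x y * g y ∂ν := by
          rw [ENNReal.mul_rpow_of_nonneg _ _ hp.le, ENNReal.mul_rpow_of_nonneg _ _ (by positivity),
            ENNReal.mul_rpow_of_nonneg _ _ hp.le, ← ENNReal.rpow_mul, ← ENNReal.rpow_mul,
            ← ENNReal.rpow_mul, ← ENNReal.rpow_mul, one_div_mul_cancel hp.ne', ENNReal.rpow_one,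
            show 1 / q * p = p / q by ring, show q * (p / q) = p by field_simp]
  -- Step 2: integrate in `x`, Tonelli, column hypothesis
  have hFm : Measurable (uncurry fun x y => u x ^ p * (K x y * g y)) :=
    ((hu.pow_const _).comp measurable_fst).mul (hK.mul (hgm.comp measurable_snd))
  calc ∫⁻ x, (∫⁻ y, K x y * f y ∂ν) ^ p ∂μ
      ≤ ∫⁻ x, C₁ ^ (p / q) * u x ^ p * ∫⁻ y, K x y * g y ∂ν ∂μ := lintegral_mono_ae h1
    _ = C₁ ^ (p / q) * ∫⁻ x, ∫⁻ y, u x ^ p * (K x y * g y) ∂ν ∂μ := by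
        rw [← lintegral_const_mul _ hFm.lintegral_prod_right]
        refine lintegral_congr fun x => ?_
        rw [mul_assoc, ← lintegral_const_mul _ ((hKx x).fun_mul hgm)]
    _ = C₁ ^ (p / q) * ∫⁻ y, ∫⁻ x, u x ^ p * (K x y * g y) ∂μ ∂ν := by
        rw [lintegral_lintegral_swap hFm.aemeasurable]
    _ = C₁ ^ (p / q) * ∫⁻ y, g y * ∫⁻ x, K x y * u x ^ p ∂μ ∂ν := by
        congr 1
        refine lintegral_congr fun y => ?_
        rw [← lintegral_const_mul _ ((hKy y).fun_mul (hu.pow_const _))]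
        exact lintegral_congr fun x => by ring
    _ ≤ C₁ ^ (p / q) * ∫⁻ y, g y * (C₂ * v y ^ p) ∂ν := by
        gcongr 1
        refine lintegral_mono_ae ?_
        filter_upwards [hcol] with y hy
        gcongr
    _ = C₁ ^ (p / q) * ∫⁻ y, C₂ * f y ^ p ∂ν := by
        congr 1
        refine lintegral_congr_ae ?_
        filter_upwards [hv0, hvtop] with y h0 htop
        simp only [hg]
        rw [ENNReal.mul_rpow_of_nonneg _ _ hp.le, ENNReal.inv_rpow]
        calc f y ^ p * (v y ^ p)⁻¹ * (C₂ * v y ^ p) = C₂ * f y ^ p * ((v y ^ p)⁻¹ * v y ^ p) := by ring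
          _ = C₂ * f y ^ p := by
              rw [ENNReal.inv_mul_cancel (ENNReal.rpow_pos_of_nonneg (pos_iff_ne_zero.2 h0) hp.le).ne'
                (ENNReal.rpow_ne_top_of_nonneg hp.le htop), mul_one]
    _ = C₁ ^ (p / q) * C₂ * ∫⁻ y, f y ^ p ∂ν := by
        rw [lintegral_const_mul _ (hf.pow_const _), mul_assoc]

end Literature.Analysis.SingularIntegrals

end
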